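import Mathlib
import HarnessLib
import Summits.RiemannHypothesis.RiemannHypothesis.Theorems.RuelleBandAsymptoticCriticalLineLasotaYorkeEngine

/-!
# RuelleBand / `AsymptoticCriticalLine`: the Lasota–Yorke engine WITH A RATE (abstract band theorem)

Route `RiemannHypothesis/RuelleBand`, crux item stmt-RiemannHypothesis-2063
(`AsymptoticCriticalLine`, "ACL"), line `interior-edge-split`, helper file (`--supports`; registered
periphery stub `finite_jointExponents_of_lasotaYorkeRate`). Everything is proved; no definitions.

WHAT. The abstract operator-theoretic content of the landed engine
`asymptoticCriticalLine_of_lasotaYorkeRealisation` (`…LasotaYorkeEngine.lean`: rate `0`, exponents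
`ρ - 1/2` at the zeta zeros), now with a RATE PARAMETER `λ ∈ ℝ` (any sign) and no arithmetic input.
Let `H` be a complex Hilbert space, `w` a seminorm on `H` whose restriction to the unit ball is
totally bounded (finite `w`-nets), `T : ℝ → (H →L[ℂ] H)` a family with the semigroup law on
`t ≥ 0`, and `t₀ > 0` a time at which the a-priori two-norm Lasota–Yorke inequality
`‖(T t₀)ⁿ f‖ ≤ C_ε e^{n (λ + ε) t₀} ‖f‖ + R_{n,ε} w(f)` holds for every `ε > 0` (Hennion's reading:
`r_ess(T t₀) ≤ e^{λ t₀}`). Then for every `ε > 0` the one-sided joint exponents `z` — those with a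
vector `v ≠ 0` such that `T t v = e^{t z} v` for all `t ≥ 0` — with `Re z ≥ λ + ε` are finitely
many: `finite_jointExponents_of_lasotaYorkeRate`. At `λ = 0`, fed with the exponents `ρ - 1/2` of
the strip zeros and the reflection `ρ ↦ 1 - ρ`, this is exactly the crux engine.

READING FOR THE LINE (a no-go for windowed spaces). On a weight-window completion of Meyer's space
(window parameter `a`) the best possible rate of an a-priori Lasota–Yorke inequality for the
half-density-normalised scaling semigroup is `λ = 1/2 - a`, and the band `Re z ≥ λ + ε` that this
theorem then controls contains NONE of the exponents of the zeros the window sees: a Lasota–Yorke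
inequality on windowed spaces cannot supply the interior stub of the line
(`stub_noRightInteriorBand`); only a norm with rate `λ ≤ 0` — the pinned anisotropic norm of the
programme item `MeyerLasotaYorke` (stmt-RiemannHypothesis-11050) — can.

PROOF. Fix `ε > 0`. Take the inequality at rate `λ + ε/4` and a power `N = n + 1` with
`E := e^{N t₀ ε/4} ≥ 2C + 1`; put `L := e^{N λ t₀}`, so that `‖T_{t₀}^N f‖ ≤ C L E ‖f‖ + R w(f)`.
Hennion's decomposition (`hennion_decomposition`, landed: the Hilbert-space form of Hennion 1993 /
Ionescu-Tulcea–Marinescu) with slack `δ := L` splits `T_{t₀}^N = T(N t₀) = S + K` with `K`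
compact and `‖S‖ ≤ 2 C L E + L ≤ L E²`. RESCALE by `a := λ + ε/2`: `T̃ t := e^{-a t} T t` has
`T̃(N t₀) = S̃ + K̃` with `‖S̃‖ ≤ e^{-a N t₀} L E² = 1` (so `σ(S̃)` lies in the closed unit disc)
and `K̃` compact, and a joint exponent `z` of `T` is the joint exponent `z - a` of `T̃` (same
vector); the landed exterior engine `finite_jointEigenvalues_re_ge_of_spectrum_subset` (analytic
Fredholm alternative outside the unit disc; `RuelleBandBandRealisationOneSided.lean`) leaves
finitely many exponents of `T̃` with real part `≥ ε/2`, into which the band `Re z ≥ λ + ε` injects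
by `z ↦ z - a`. Sources: H. Hennion, Proc. AMS 118 (1993) 627–634; C. T. Ionescu Tulcea –
G. Marinescu, Ann. of Math. 52 (1950); V. Baladi, *Positive transfer operators and decay of
correlations* (2000) §2.3; F. Faure – M. Tsujii, arXiv:1301.5525 §3.
-/

noncomputable section

-- D-0017: `Summit.<S>.<S>.…` is the designed namespace of a single-problem summit.
set_option linter.dupNamespace false

namespace Summit.RiemannHypothesis.RiemannHypothesis.Theorems

open Complex Filter Topology Set Metric

/-- **THE LASOTA–YORKE ENGINE WITH A RATE.** A complex Hilbert space `H`, a seminorm `w` on `H`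
whose restriction to the unit ball is totally bounded, a family `T : ℝ → (H →L[ℂ] H)` with the
semigroup law on `t ≥ 0`, and a time `t₀ > 0` with the a-priori two-norm Lasota–Yorke inequality
`‖(T t₀)ⁿ f‖ ≤ C_ε e^{n (λ + ε) t₀} ‖f‖ + R_{n,ε} w(f)` for every `ε > 0` (essential spectral
radius `≤ e^{λ t₀}`): for every `ε > 0` only finitely many `z` with `Re z ≥ λ + ε` carry a one-sided
joint eigenvector `T t v = e^{t z} v` (`t ≥ 0`, `v ≠ 0`). Hennion's decomposition + rescaling by
`e^{-(λ + ε/2) t}` + the exterior analytic-Fredholm engine. [folklore] -/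
theorem finite_jointExponents_of_lasotaYorkeRate :
    ∀ (H : Type) (_ : NormedAddCommGroup H) (_ : InnerProductSpace ℂ H) (_ : CompleteSpace H) (w : Seminorm ℂ H) (T : ℝ → H →L[ℂ] H) (t₀ lam : ℝ), 0 < t₀ → (∀ s t : ℝ, 0 ≤ s → 0 ≤ t → T (s + t) = (T s).comp (T t)) → (∀ η : ℝ, 0 < η → ∃ F : Finset H, ∀ f : H, ‖f‖ ≤ 1 → ∃ g ∈ F, w (f - g) < η) → (∀ ε : ℝ, 0 < ε → ∃ C : ℝ, ∀ n : ℕ, ∃ R : ℝ, ∀ f : H, ‖(T t₀ ^ n) f‖ ≤ C * Real.exp ((n : ℝ) * (lam + ε) * t₀) * ‖f‖ + R * w f) → ∀ ε : ℝ, 0 < ε → {z : ℂ | lam + ε ≤ z.re ∧ ∃ v : H, v ≠ 0 ∧ ∀ t : ℝ, 0 ≤ t → T t v = Complex.exp (↑t * z) • v}.Finite := by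
  intro H _ _ _ w T t₀ lam ht₀ hT hw hLY ε hε
  -- (1) the a-priori inequality at rate `lam + ε/4`, constants made nonnegative
  obtain ⟨C, hC⟩ := hLY (ε / 4) (by positivity)
  set C' : ℝ := max C 1 with hC'def
  have hC'1 : 1 ≤ C' := le_max_right _ _
  have hκ : 0 < ε / 4 * t₀ := by positivity
  -- (2) a power `N = n + 1` with `e^{N t₀ ε/4} ≥ 2C' + 1`, and the rate factor `L = e^{N lam t₀}`
  obtain ⟨n, hn⟩ := exists_nat_le_exp_mul hκ (2 * C' + 1)
  set E : ℝ := Real.exp (((n : ℝ) + 1) * (ε / 4 * t₀)) with hEdef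
  have hE1 : 1 ≤ E := by linarith
  have hE0 : 0 ≤ E := by linarith
  set L : ℝ := Real.exp (((n : ℝ) + 1) * lam * t₀) with hLdef
  have hL : 0 < L := Real.exp_pos _
  obtain ⟨R, hR⟩ := hC (n + 1)
  set R' : ℝ := max R 0 with hR'def
  set r : ℝ := C' * (L * E) with hrdef
  have hr0 : 0 ≤ r := by positivity
  have hLY1 : ∀ f : H, ‖(T t₀ ^ (n + 1)) f‖ ≤ r * ‖f‖ + R' * w f := by
    intro f
    have h := hR f
    have hw0 : 0 ≤ w f := apply_nonneg w f
    have hcast : Real.exp ((((n + 1 : ℕ) : ℝ)) * (lam + ε / 4) * t₀) = L * E := by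
      rw [hLdef, hEdef, ← Real.exp_add]; congr 1; push_cast; ring
    rw [hcast] at h
    calc ‖(T t₀ ^ (n + 1)) f‖ ≤ C * (L * E) * ‖f‖ + R * w f := h
      _ ≤ C' * (L * E) * ‖f‖ + R' * w f := by
          have hLE0 : 0 ≤ L * E := by positivity
          have h1 : C * (L * E) * ‖f‖ ≤ C' * (L * E) * ‖f‖ :=
            mul_le_mul_of_nonneg_right (mul_le_mul_of_nonneg_right (le_max_left C 1) hLE0)
              (norm_nonneg f)
          have h2 : R * w f ≤ R' * w f := mul_le_mul_of_nonneg_right (le_max_left R 0) hw0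
          linarith
  -- (3) Hennion with slack `δ = L`: `T t₀ ^ N = S + K`, `K` compact, `‖S‖ ≤ 2r + L ≤ L E²`
  obtain ⟨S, K, hSK, hK, hS⟩ := hennion_decomposition H inferInstance inferInstance inferInstance
    (T t₀ ^ (n + 1)) w r R' L hr0 (le_max_right R 0) hL hLY1 hw
  have hSE : ‖S‖ ≤ L * (E * E) := by
    have h1 : 2 * C' * E + 1 ≤ E * E := by
      nlinarith [mul_nonneg hE0 (by linarith : (0 : ℝ) ≤ E - (2 * C' + 1))]
    have h2 : 2 * r + L = L * (2 * C' * E + 1) := by rw [hrdef]; ring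
    calc ‖S‖ ≤ 2 * r + L := hS
      _ = L * (2 * C' * E + 1) := h2
      _ ≤ L * (E * E) := mul_le_mul_of_nonneg_left h1 hL.le
  -- (4) rescale by `a = lam + ε/2`
  set a : ℝ := lam + ε / 2 with hadef
  set τ : ℝ := ((n : ℝ) + 1) * t₀ with hτdef
  have hτ : 0 < τ := by positivity
  have hTτ : T τ = T t₀ ^ (n + 1) := (pow_succ_eq_of_semigroup_nonneg T ht₀.le hT n).symm
  have haτ : Real.exp (a * τ) = L * (E * E) := by
    rw [hLdef, hEdef, ← Real.exp_add, ← Real.exp_add]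
    congr 1
    rw [hadef, hτdef]
    ring
  set c : ℝ := Real.exp (-(a * τ)) with hcdef
  have hc0 : 0 < c := Real.exp_pos _
  have hcE : c * (L * (E * E)) = 1 := by
    rw [← haτ, hcdef, ← Real.exp_add]; simp
  let Ta : ℝ → H →L[ℂ] H := fun t => (((Real.exp (-(a * t)) : ℝ) : ℂ)) • T t
  set Sa : H →L[ℂ] H := ((c : ℝ) : ℂ) • S with hSadef
  have hKa : IsCompactOperator (Ta τ - Sa) := by
    have h1 : Ta τ - Sa = ((c : ℝ) : ℂ) • K := by
      simp only [Ta, hSadef, hTτ, hSK, smul_add, ← hcdef]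
      abel
    rw [h1]
    exact hK.smul ((c : ℝ) : ℂ)
  have hSa : spectrum ℂ Sa ⊆ closedBall (0 : ℂ) 1 := by
    intro μ hμ
    rw [mem_closedBall, dist_zero_right]
    have h1 : ‖μ‖ ≤ ‖Sa‖ * ‖(1 : H →L[ℂ] H)‖ := spectrum.norm_le_norm_mul_of_mem hμ
    have h2 : ‖(1 : H →L[ℂ] H)‖ ≤ 1 := ContinuousLinearMap.norm_id_le
    have h3 : ‖Sa‖ ≤ 1 := by
      rw [hSadef, norm_smul, Complex.norm_real, Real.norm_of_nonneg hc0.le]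
      calc c * ‖S‖ ≤ c * (L * (E * E)) := by gcongr
        _ = 1 := hcE
    calc ‖μ‖ ≤ ‖Sa‖ * ‖(1 : H →L[ℂ] H)‖ := h1
      _ ≤ 1 * 1 := mul_le_mul h3 h2 (norm_nonneg _) zero_le_one
      _ = 1 := one_mul 1
  -- (5) the exterior engine for the rescaled family at time `τ`, level `ε/2`; inject by `z ↦ z - a`
  have hfin := finite_jointEigenvalues_re_ge_of_spectrum_subset Ta hτ hSa hKa (half_pos hε)
  refine (hfin.preimage (f := fun z : ℂ => z - (a : ℂ))
    (fun x _ y _ h => sub_left_injective h)).subset ?_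
  rintro z ⟨hz, v, hv0, hv⟩
  refine ⟨?_, v, hv0, fun t ht => ?_⟩
  · have hre : (z - (a : ℂ)).re = z.re - a := by simp [Complex.sub_re]
    show ε / 2 ≤ (z - (a : ℂ)).re
    rw [hre, hadef]
    linarith
  · exact rescale_jointEigenvector T a (hv t ht)

end Summit.RiemannHypothesis.RiemannHypothesis.Theorems

end
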